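import Literature.Geometry.GeometricMeasureTheory.IntegralCurrentsDimZero
import Literature.Geometry.GeometricMeasureTheory.CurrentsPolar
import Literature.Geometry.GeometricMeasureTheory.CurrentsSlicing
import Mathlib.MeasureTheory.Covering.BesicovitchVectorSpace
import Mathlib.MeasureTheory.Measure.Support
import HarnessLib

/-!
# A finite-mass `0`-current with integer ball values is a finite integral chain

Support file for the boundary-rectifiability theorem [Federer1969, 4.2.16 (2)], base case: a
`0`-current `Z` of finite mass whose "measure of closed balls" `(Z ⌞ 𝐁(x,r))(1)` is an integer
for every centre `x` and almost every radius `r > 0` is a finite sum `Σ nᵢ δ_{xᵢ}` with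
`nᵢ ∈ ℤ`, i.e. `Z ∈ 𝓡_0(V)` [Federer1969, 4.2.16 (2) for `m = 0`, via 4.1.28 and 2.9: the signed
measure `Z` has `|dZ/d‖Z‖| = 1`, so at `‖Z‖`-almost every point the ball values are comparable to
`‖Z‖(𝐁(x,r)) > 0` (Besicovitch–Lebesgue differentiation) and cannot be eventually `0`; hence
almost every point is an atom, each atom has mass `≥ 1`, and there are finitely many].

* `covector_zero_eq_smul` — a `0`-covector is its value on the empty frame times the unit;
* **`Current.isRectifiable_zero_of_ae_int_ball`** — the statement above.

Theorems only; no new definitions, no named facts.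

## References

* H. Federer, *Geometric Measure Theory*, Springer 1969, 2.9.8, 4.1.5, 4.1.28, 4.2.16
  [Federer1969].
-/

noncomputable section

open scoped ENNReal NNReal Topology
open MeasureTheory TopologicalSpace Set Filter Metric Function

namespace Literature.Geometry.GeometricMeasureTheory

set_option maxSynthPendingDepth 2

section ZeroCovector

variable {V : Type*} [NormedAddCommGroup V] [NormedSpace ℝ V]

/-- A `0`-covector is determined by its value on the empty frame:
`ω = ω(⋆) · 1` (`∧⁰ V = ℝ`). [cite: Federer1969, 1.4.1] -/
theorem covector_zero_eq_smul (ω : Covector V 0) :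
    ω = (ω ![]) • ContinuousAlternatingMap.constOfIsEmpty ℝ V (Fin 0) (1 : ℝ) := by
  ext w
  have hw : w = ![] := Subsingleton.elim _ _
  simp [hw]

/-- The unit `0`-covector has (co)mass at most one. [cite: Federer1969, 1.8.1] -/
theorem norm_constOfIsEmpty_one_le :
    ‖(ContinuousAlternatingMap.constOfIsEmpty ℝ V (Fin 0) (1 : ℝ) : Covector V 0)‖ ≤ 1 :=
  ContinuousAlternatingMap.opNorm_le_bound _ zero_le_one fun w => by simp

end ZeroCovector

section IntegerBall

variable {V : Type*} [NormedAddCommGroup V] [InnerProductSpace ℝ V] [FiniteDimensional ℝ V]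
  [MeasurableSpace V] [BorelSpace V]

/-- An a.e. property on `ℝ` holds somewhere in every nondegenerate interval. [folklore] -/
private theorem exists_mem_Ioo_of_ae {p : ℝ → Prop} (h : ∀ᵐ r, p r) {a b : ℝ} (hab : a < b) :
    ∃ r ∈ Ioo a b, p r := by
  by_contra H
  simp only [not_exists, not_and] at H
  have h0 : volume (Ioo a b) = 0 := measure_mono_null (fun r hr => H r hr) (ae_iff.1 h)
  rw [Real.volume_Ioo] at h0
  exact absurd h0 (by rw [ENNReal.ofReal_eq_zero, not_le]; linarith)

/-- An a.e. property holds at every atom. [folklore] -/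
private theorem of_ae_of_measure_singleton_ne_zero {α : Type*} [MeasurableSpace α] {μ : Measure α}
    {p : α → Prop} (h : ∀ᵐ y ∂μ, p y) {x : α} (hx : μ {x} ≠ 0) : p x := by
  by_contra H
  exact hx (measure_mono_null (fun y hy => by rw [mem_singleton_iff.1 hy]; exact H) (ae_iff.1 h))

/-- **A finite-mass `0`-current with integer ball values is a finite integral chain**
[Federer1969, 4.2.16 (2), `m = 0`]: if `𝐌(Z) < ∞`, `χ` is a `0`-form equal to the unit on a
set `U ⊇ spt Z`, and for every `x` and almost every `r > 0` the number
`(Z ⌞ 𝐁(x,r))(χ)` is an integer, then `Z ∈ 𝓡_0(V)`. Proof: write `Z = ‖Z‖ ∧ Z⃗` with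
`Z⃗ = ρ · 1`, `|ρ| = 1` a.e. (4.1.5); `(Z ⌞ A)(χ) = ∫_A ρ d‖Z‖`; by dominated convergence the
ball values tend to `ρ(x) ‖Z‖{x} ∈ ℤ` as `r ↓ 0`; at a `‖Z‖`-Lebesgue point of `ρ` in the
support of `‖Z‖` that is not an atom they are eventually `0` yet `≥ |ρ(x)| ‖Z‖(𝐁(x,r)) / 2 > 0`
(Besicovitch differentiation) — so almost every point is an atom, atoms have mass `≥ 1`, there
are finitely many, and `Z = Σ nᵢ δ_{xᵢ}`. [cite: Federer1969, 2.9.8, 4.1.5, 4.1.28, 4.2.16] -/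
theorem Current.isRectifiable_zero_of_ae_int_ball {Z : Current (⊤ : Opens V) 0} (hZ : Z.mass ≠ ⊤)
    {U : Set V} (hZU : Z.support ⊆ U) (χ : TestForm (⊤ : Opens V) 0)
    (hχ : ∀ y ∈ U, χ y ![] = 1)
    (h : ∀ x, ∀ᵐ r : ℝ, 0 < r → ∃ k : ℤ,
      (Z.isRepresentable_of_mass_ne_top hZ).restrictSet (closedBall x r) measurableSet_closedBall χ = k) :
    Z.IsRectifiable := by
  classical
  set hZr := Z.isRepresentable_of_mass_ne_top hZ
  set μ := Z.variation with hμ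
  haveI : IsFiniteMeasure μ := Z.isFiniteMeasure_variation hZ
  set u₀ : Covector V 0 := ContinuousAlternatingMap.constOfIsEmpty ℝ V (Fin 0) (1 : ℝ) with hu₀
  set P := hZr.polar hZ with hP
  set ρ : V → ℝ := fun x => P x u₀ with hρdef
  /- Step 1: the polar field is `ρ · 1` with `0 < |ρ| ≤ 1` a.e. -/
  have hPω : ∀ x (ω : Covector V 0), P x ω = ω ![] * ρ x := fun x ω => by
    conv_lhs => rw [covector_zero_eq_smul ω]
    rw [map_smul, smul_eq_mul]
  have hρint : Integrable ρ μ := hZr.integrable_polar_apply hZ (integrable_const u₀)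
  have hρae : ∀ᵐ x ∂μ, ρ x ≠ 0 ∧ |ρ x| ≤ 1 := by
    filter_upwards [hZr.norm_polar_ae_eq_one hZ] with x hx
    have hx1 : ‖P x‖ = 1 := hx
    refine ⟨fun h0 => ?_, ?_⟩
    · have : P x = 0 := by
        ext ω; rw [hPω, h0, mul_zero]; rfl
      rw [this, norm_zero] at hx1
      exact zero_ne_one hx1
    · calc |ρ x| = ‖P x u₀‖ := (Real.norm_eq_abs _).symm
        _ ≤ ‖P x‖ * ‖u₀‖ := ContinuousLinearMap.le_opNorm _ _
        _ ≤ 1 * 1 := mul_le_mul hx1.le norm_constOfIsEmpty_one_le (norm_nonneg _) zero_le_one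
        _ = 1 := one_mul _
  /- Step 2: ball values are integrals of `ρ`. -/
  have hμU : μ Uᶜ = 0 :=
    measure_mono_null (fun y hy => show y ∈ ((⊤ : Opens V) : Set V) \ Z.support from
        ⟨trivial, fun hy' => hy (hZU hy')⟩)
      (Z.variation_eq_zero_of_disjoint_support Z.isOpen_sdiff_support disjoint_sdiff_left)
  have hχae : ∀ᵐ x ∂μ, χ x ![] = 1 := by
    have : ∀ᵐ x ∂μ, x ∈ U := by
      rw [ae_iff]; simpa only [← compl_setOf, setOf_mem_eq] using hμU
    exact this.mono fun x hx => hχ x hx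
  set ν : Set V → ℝ := fun A => ∫ x in A, ρ x ∂μ with hνdef
  have hνeq : ∀ (A : Set V) (hA : MeasurableSet A), hZr.restrictSet A hA χ = ν A := by
    intro A hA
    have hli : LocallyIntegrableOn P ((⊤ : Opens V) : Set V) (μ.restrict A) := fun x hx =>
      let ⟨W, hW, hi⟩ := hZr.locallyIntegrableOn_polar hZ x hx
      ⟨W, hW, hi.mono_measure Measure.restrict_le_self⟩
    rw [hZr.restrictSet_eq_vectorCurrent_polar hZ A hA, vectorCurrent_apply hli]
    refine integral_congr_ae ?_
    filter_upwards [ae_restrict_of_ae (μ := μ) (s := A) hχae] with x hx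
    rw [hPω, hx, one_mul]
  have hball : ∀ x, ∀ᵐ r : ℝ, 0 < r → ∃ k : ℤ, ν (closedBall x r) = k := fun x =>
    (h x).mono fun r hr hr0 => by rw [← hνeq]; exact hr hr0
  /- Step 3: ball values tend to `ρ(x) ‖Z‖{x}` as `r ↓ 0`. -/
  have hlim : ∀ x (r : ℕ → ℝ), (∀ k, 0 < r k) → Tendsto r atTop (𝓝 0) →
      Tendsto (fun k => ν (closedBall x (r k))) atTop (𝓝 (ρ x * μ.real {x})) := by
    intro x r hr hr0
    have hlim' : Tendsto (fun k => ∫ y, (closedBall x (r k)).indicator ρ y ∂μ) atTop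
        (𝓝 (∫ y, ({x} : Set V).indicator ρ y ∂μ)) := by
      refine tendsto_integral_of_dominated_convergence (fun y => |ρ y|)
        (fun k => (hρint.indicator measurableSet_closedBall).aestronglyMeasurable) hρint.abs
        (fun k => Eventually.of_forall fun y => ?_) (Eventually.of_forall fun y => ?_)
      · rw [Real.norm_eq_abs]
        by_cases hy : y ∈ closedBall x (r k)
        · rw [indicator_of_mem hy]
        · rw [indicator_of_notMem hy, abs_zero]; exact abs_nonneg _
      · by_cases hyx : y = x
        · subst hyx
          simp only [mem_closedBall, dist_self, (hr _).le, indicator_of_mem, mem_singleton_iff]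
          exact tendsto_const_nhds
        · have hd : 0 < dist y x := dist_pos.2 hyx
          have hev : ∀ᶠ k in atTop, (closedBall x (r k)).indicator ρ y = 0 := by
            filter_upwards [(tendsto_order.1 hr0).2 _ hd] with k hk
            exact indicator_of_notMem (by rw [mem_closedBall, not_le]; exact hk) _
          rw [indicator_of_notMem (show y ∉ ({x} : Set V) from hyx)]
          exact tendsto_const_nhds.congr' (EventuallyEq.symm hev)
    simp only [integral_indicator measurableSet_closedBall,
      integral_indicator (measurableSet_singleton x), integral_singleton, smul_eq_mul] at hlim'
    simpa only [hνdef, mul_comm (ρ x)] using hlim'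
  /- Step 4: good radii and integrality of `ρ(x) ‖Z‖{x}`. -/
  have hgood : ∀ x, ∃ r : ℕ → ℝ, (∀ k, 0 < r k) ∧ Tendsto r atTop (𝓝 0) ∧
      ∀ k, ∃ m : ℤ, ν (closedBall x (r k)) = m := by
    intro x
    have hex : ∀ k : ℕ, ∃ r ∈ Ioo (0 : ℝ) (1 / ((k : ℝ) + 1)), (0 < r → ∃ m : ℤ, ν (closedBall x r) = m) :=
      fun k => exists_mem_Ioo_of_ae (hball x) (by positivity)
    choose r hr hrint using hex
    refine ⟨r, fun k => (hr k).1, ?_, fun k => hrint k (hr k).1⟩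
    exact squeeze_zero (fun k => (hr k).1.le) (fun k => (hr k).2.le) tendsto_one_div_add_atTop_nhds_zero_nat
  have hZclosed : IsClosed (range ((↑) : ℤ → ℝ)) := Int.isClosedEmbedding_coe_real.isClosed_range
  have hint : ∀ x, ∃ m : ℤ, ρ x * μ.real {x} = m := by
    intro x
    obtain ⟨r, hr, hr0, hrint⟩ := hgood x
    have hmem : ρ x * μ.real {x} ∈ range ((↑) : ℤ → ℝ) :=
      hZclosed.mem_of_tendsto (hlim x r hr hr0) (Eventually.of_forall fun k => by
        obtain ⟨m, hm⟩ := hrint k; exact ⟨m, hm.symm⟩)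
    obtain ⟨m, hm⟩ := hmem
    exact ⟨m, hm.symm⟩
  choose nZ hnZ using hint
  /- Step 5: atoms have mass at least one; there are finitely many. -/
  have hatom : ∀ x, μ {x} ≠ 0 → 1 ≤ μ.real {x} := by
    intro x hx
    obtain ⟨hρ0, hρ1⟩ := of_ae_of_measure_singleton_ne_zero hρae hx
    have hreal : 0 < μ.real {x} := ENNReal.toReal_pos hx (measure_ne_top μ _)
    have hm0 : (nZ x : ℝ) ≠ 0 := by rw [← hnZ]; exact mul_ne_zero hρ0 hreal.ne'
    have hm1 : (1 : ℝ) ≤ |(nZ x : ℝ)| := by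
      rw [← Int.cast_abs, ← Int.cast_one, Int.cast_le]
      exact Int.one_le_abs (by exact_mod_cast hm0)
    rw [← hnZ, abs_mul, abs_of_pos hreal] at hm1
    nlinarith
  set A : Set V := {x | μ {x} ≠ 0} with hAdef
  have hAfin : A.Finite := by
    by_contra hinf
    obtain ⟨t, htA, hcard⟩ := Set.Infinite.exists_subset_card_eq hinf (⌊μ.real univ⌋₊ + 1)
    have h1 : (t.card : ℝ≥0∞) ≤ μ univ := by
      calc (t.card : ℝ≥0∞) = ∑ x ∈ t, (1 : ℝ≥0∞) := by simp
        _ ≤ ∑ x ∈ t, μ {x} := Finset.sum_le_sum fun x hx => by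
            have := hatom x (htA hx)
            rw [← ENNReal.ofReal_one, ← ENNReal.ofReal_toReal (measure_ne_top μ {x})]
            exact ENNReal.ofReal_le_ofReal this
        _ = μ ↑t := sum_measure_singleton
        _ ≤ μ univ := measure_mono (subset_univ _)
    have h2 : (t.card : ℝ) ≤ μ.real univ := by
      have := ENNReal.toReal_mono (measure_ne_top μ univ) h1
      rw [measureReal_def]
      simpa using this
    rw [hcard] at h2
    have h3 := Nat.lt_floor_add_one (μ.real univ)
    push_cast at h2
    linarith
  /- Step 6: almost every point is an atom (Besicovitch–Lebesgue differentiation). -/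
  have hleb : ∀ᵐ x ∂μ, Tendsto (fun r => ⨍ y in closedBall x r, ‖ρ y - ρ x‖ ∂μ) (𝓝[>] 0) (𝓝 0) :=
    ((Besicovitch.vitaliFamily μ).ae_tendsto_average_norm_sub hρint.locallyIntegrable).mono
      fun x hx => hx.comp (Besicovitch.tendsto_filterAt μ x)
  have hsuppμ : ∀ᵐ x ∂μ, x ∈ μ.support := by
    rw [ae_iff]
    simpa only [← compl_setOf, setOf_mem_eq] using (Measure.measure_compl_support (μ := μ))
  have hμA : ∀ᵐ x ∂μ, x ∈ A := by
    filter_upwards [hρae, hleb, hsuppμ] with x hρx hxleb hxsupp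
    obtain ⟨hρ0, -⟩ := hρx
    by_contra hxA
    have hx0 : μ {x} = 0 := by simpa [hAdef] using hxA
    obtain ⟨r, hr, hr0, hrint⟩ := hgood x
    have hr0' : Tendsto r atTop (𝓝[>] 0) :=
      tendsto_nhdsWithin_iff.2 ⟨hr0, Eventually.of_forall hr⟩
    -- (a) the ball values are eventually `0`
    have hev0 : ∀ᶠ k in atTop, ν (closedBall x (r k)) = 0 := by
      have ht := hlim x r hr hr0
      rw [show μ.real {x} = 0 by rw [measureReal_def, hx0, ENNReal.toReal_zero], mul_zero] at ht
      have ht' : Tendsto (fun k => |ν (closedBall x (r k))|) atTop (𝓝 0) := by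
        have := (continuous_abs.tendsto (0 : ℝ)).comp ht
        rw [abs_zero] at this
        exact this
      filter_upwards [(tendsto_order.1 ht').2 1 one_pos] with k hk
      obtain ⟨m, hm⟩ := hrint k
      have hk' : |ν (closedBall x (r k))| < 1 := hk
      rw [hm] at hk' ⊢
      rw [← Int.cast_abs, ← Int.cast_one, Int.cast_lt] at hk'
      exact_mod_cast Int.abs_lt_one_iff.1 hk'
    -- (b) balls have positive measure
    have hpos : ∀ k, 0 < μ.real (closedBall x (r k)) := by
      intro k
      have hfr := Measure.mem_support_iff.1 hxsupp
      have hev : ∀ᶠ u in (𝓝 x).smallSets, u ⊆ closedBall x (r k) :=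
        Filter.eventually_smallSets_subset.2 (closedBall_mem_nhds x (hr k))
      obtain ⟨u, hu0, husub⟩ := (hfr.and_eventually hev).exists
      exact ENNReal.toReal_pos (ne_of_gt (lt_of_lt_of_le hu0 (measure_mono husub)))
        (measure_ne_top μ _)
    -- (c) at a Lebesgue point the ball values are `≥ |ρ x| ‖Z‖(𝐁) / 2`
    have hleb' := hxleb.comp hr0'
    have hevL : ∀ᶠ k in atTop, ⨍ y in closedBall x (r k), ‖ρ y - ρ x‖ ∂μ < |ρ x| / 2 :=
      (tendsto_order.1 hleb').2 _ (by positivity)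
    obtain ⟨k, hk0, hkL⟩ := (hev0.and hevL).exists
    have hμB := hpos k
    set Bk := closedBall x (r k)
    have hIs : IntegrableOn (fun y => ρ y - ρ x) Bk μ :=
      hρint.integrableOn.sub (integrableOn_const (measure_ne_top μ _))
    have hdiff : ν Bk - ρ x * μ.real Bk = ∫ y in Bk, (ρ y - ρ x) ∂μ := by
      rw [integral_sub hρint.integrableOn (integrableOn_const (measure_ne_top μ _)),
        setIntegral_const, smul_eq_mul, mul_comm]
    have hle : |ν Bk - ρ x * μ.real Bk| ≤ μ.real Bk * ⨍ y in Bk, ‖ρ y - ρ x‖ ∂μ := by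
      rw [hdiff, setAverage_eq, smul_eq_mul, ← mul_assoc, mul_inv_cancel₀ hμB.ne', one_mul]
      have := norm_integral_le_integral_norm (fun y => ρ y - ρ x) (μ := μ.restrict Bk)
      rwa [Real.norm_eq_abs] at this
    rw [hk0, zero_sub, abs_neg, abs_mul, abs_of_pos hμB] at hle
    have : |ρ x| * μ.real Bk < μ.real Bk * (|ρ x| / 2) :=
      lt_of_le_of_lt hle (mul_lt_mul_of_pos_left hkL hμB)
    nlinarith [abs_pos.2 hρ0]
  /- Step 7: `Z = Σ_{x ∈ A} n(x) δ_x`. -/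
  set F : Finset V := hAfin.toFinset with hF
  have hμF : μ.restrict (↑F : Set V) = μ :=
    Measure.restrict_eq_self_of_ae_mem (hμA.mono fun x hx => by simpa [hF] using hx)
  have hZF : Z = currentOfIntegration (↑F : Set V) nZ (fun _ => ![]) := by
    ext φ
    rw [currentOfIntegration_finset_apply, hZr.apply_eq_integral_polar hZ φ]
    have hg : Integrable (fun x => φ x ![] * ρ x) μ :=
      (hZr.integrable_polar_apply hZ (hZr.integrable_testForm φ)).congr
        (Eventually.of_forall fun x => hPω x (φ x))
    calc ∫ x, P x (φ x) ∂μ = ∫ x, φ x ![] * ρ x ∂μ := integral_congr_ae (Eventually.of_forall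
          fun x => hPω x (φ x))
      _ = ∫ x in (↑F : Set V), φ x ![] * ρ x ∂μ := by rw [hμF]
      _ = ∑ x ∈ F, μ.real {x} • (φ x ![] * ρ x) :=
          setIntegral_finset F (by rw [IntegrableOn, hμF]; exact hg)
      _ = ∑ x ∈ F, (nZ x : ℝ) * φ x ![] := Finset.sum_congr rfl fun x _ => by
          rw [← hnZ, smul_eq_mul]; ring
  rw [hZF]
  exact isRectifiable_currentOfIntegration_finset F nZ fun _ _ => trivial

end IntegerBall

end Literature.Geometry.GeometricMeasureTheory
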